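import Summits.ResolutionOfSingularities.ResolutionOfSingularities.Theorems.TeissierJungTeissierReductionZariskiFrameStep
import Summits.ResolutionOfSingularities.ResolutionOfSingularities.Theorems.TeissierJungTeissierReductionZariskiFiniteValue
import Literature.AlgebraicGeometry.Resolution.QuadraticSequenceDimOneExistence
import Literature.AlgebraicGeometry.Resolution.QuadraticTransformsKeyLemma
import HarnessLib

/-!
# Crux `TeissierReduction` (stmt-ResolutionOfSingularities-17085, route `TeissierJung`), line `Sketch`,
# stub `stub_zariskiMonomialArchimedean`: Zariski's monomialisation along a valuation (Archimedean case)

Support theorem for the crux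
`Summit.ResolutionOfSingularities.ResolutionOfSingularities.Theses.TeissierJung.TeissierReduction`
(stub `stub_zariskiMonomialArchimedean` of the line skeleton; idea card `valuative-koenig-surfaces`,
first lemma, in its corrected form). **Zariski's lemma** (Zariski 1939/1944; Zariski–Samuel II,
App. 5; Abhyankar 1956): let `R ⊆ K` be a two-dimensional regular local ring with fraction field `K`,
dominated by a valuation ring `O` of `K`, and suppose every nonzero element of `R` has FINITE value
(some power `𝔪^N` consists of elements strictly more divisible — automatic for rank-one valuations, and
for composite valuations all of whose primes are centred on the closed point). Then finitely many
nonzero `f₁, …, f_m ∈ R` become units times monomials `xᵃ yᵇ` in a generating pair `𝔪 = (x, y)` of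
the maximal ideal of some iterated quadratic transform of `R` along `O`.

Assembly of the two engine stubs landed before:
* `stub_zariskiFrameStep` (`…ZariskiFrameStep.lean`): one quadratic transform along `O` transports a
  prime frame `𝔪 = (x, y)` to a prime frame `𝔪₁ = (x₁, y₁)` with `x, y` unit-monomials in `x₁, y₁`;
* `stub_zariskiFiniteValue` (`…ZariskiFiniteValue.lean`): along the sequence of transforms equipped
  with such frames, an element of finite value becomes a unit-monomial (Abhyankar's union lemma).
Here: the sequence is the tree's `quadraticSeq O R` (it IS the sequence of transforms along `O`,
each member being regular hence Noetherian local and not a field); prime frames along it are chosen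
recursively by `stub_zariskiFrameStep` from a regular system of parameters of `R`
(`exists_frames_quadraticSeq`); `stub_zariskiFiniteValue` monomialises the PRODUCT `∏ f_j`, and the
prime generators peel off each factor (`exists_eq_unit_mul_pow_mul_pow_of_mul_eq`).

[folklore]; no definitions, no named facts.
-/

-- single-problem summit: the doubled namespace component is forced
set_option linter.dupNamespace false

noncomputable section

open IsLocalRing Literature.AlgebraicGeometry.Resolution

namespace Summit.ResolutionOfSingularities.ResolutionOfSingularities.Theorems.TeissierReduction

variable {K : Type} [Field K]

/-! ## A chain of transforms along `O` is a `ReflTransGen` chain -/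

/-- The `n`-th member of the quadratic sequence is reached from `R` by a chain of quadratic
transforms along `O`, provided each step is one. [folklore] -/
theorem reflTransGen_quadraticSeq (O : ValuationSubring K) (R : Subring K)
    (hstep : ∀ i, IsQuadraticTransformAlong O (quadraticSeq O R i) (quadraticSeq O R (i + 1)))
    (n : ℕ) : Relation.ReflTransGen (IsQuadraticTransformAlong O) R (quadraticSeq O R n) := by
  induction n with
  | zero => exact Relation.ReflTransGen.refl
  | succ n ih => exact ih.tail (hstep n)

/-! ## Prime frames along the quadratic sequence -/

/-- **Prime frames along the sequence of quadratic transforms.** For a two-dimensional regular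
local ring `R` of `K` dominated by `O`, the sequence `quadraticSeq O R` is a sequence of quadratic
transforms along `O` of regular local rings, and it carries generating pairs `𝔪_n = (x_n, y_n)` of
prime elements such that `x_n, y_n` are units times monomials in `x_{n+1}, y_{n+1}` (recursive
choice by `stub_zariskiFrameStep`, starting from a regular system of parameters of `R`). [folklore] -/
theorem exists_frames_quadraticSeq (O : ValuationSubring K) (R : Subring K) [IsRegularLocalRing R]
    (hdim : ringKrullDim R = 2) (hof : IsLocalRingOf R) (hdom : SubringDominates R O.toSubring) :
    ∃ (reg : ∀ n, IsRegularLocalRing (quadraticSeq O R n))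
      (x y : (n : ℕ) → quadraticSeq O R n),
      (∀ i, IsQuadraticTransformAlong O (quadraticSeq O R i) (quadraticSeq O R (i + 1))) ∧
      (∀ n, @maximalIdeal (quadraticSeq O R n) _ (reg n).toIsLocalRing = Ideal.span {x n, y n}) ∧
      (∀ n, Prime (x n) ∧ Prime (y n)) ∧
      (∀ n,
        (∃ (a b : ℕ) (u : quadraticSeq O R (n + 1)), IsUnit u ∧
          ((x n : K)) = (u : K) * (x (n + 1) : K) ^ a * (y (n + 1) : K) ^ b) ∧
        (∃ (a b : ℕ) (u : quadraticSeq O R (n + 1)), IsUnit u ∧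
          ((y n : K)) = (u : K) * (x (n + 1) : K) ^ a * (y (n + 1) : K) ^ b)) := by
  classical
  -- a "good frame" of the `k`-th member, as a pair of elements of `K`
  let Good : ℕ → K × K → Prop := fun k p =>
    ∃ (ha : p.1 ∈ quadraticSeq O R k) (hb : p.2 ∈ quadraticSeq O R k)
      (reg : IsRegularLocalRing (quadraticSeq O R k)),
      @maximalIdeal (quadraticSeq O R k) _ reg.toIsLocalRing =
          Ideal.span {(⟨p.1, ha⟩ : quadraticSeq O R k), ⟨p.2, hb⟩} ∧
        Prime (⟨p.1, ha⟩ : quadraticSeq O R k) ∧ Prime (⟨p.2, hb⟩ : quadraticSeq O R k) ∧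
        SubringDominates (quadraticSeq O R k) O.toSubring ∧ R ≤ quadraticSeq O R k
  -- transport of a pair to the next pair
  let Tr : ℕ → K × K → K × K → Prop := fun k p q =>
    (∃ (a b : ℕ) (u : K) (hu : u ∈ quadraticSeq O R (k + 1)),
        IsUnit (⟨u, hu⟩ : quadraticSeq O R (k + 1)) ∧ p.1 = u * q.1 ^ a * q.2 ^ b) ∧
      (∃ (a b : ℕ) (u : K) (hu : u ∈ quadraticSeq O R (k + 1)),
        IsUnit (⟨u, hu⟩ : quadraticSeq O R (k + 1)) ∧ p.2 = u * q.1 ^ a * q.2 ^ b)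
  -- the step: a good frame at stage `k` yields the transform along `O` and a good frame at `k+1`
  have step : ∀ k p, Good k p →
      IsQuadraticTransformAlong O (quadraticSeq O R k) (quadraticSeq O R (k + 1)) ∧
        ∃ q, Good (k + 1) q ∧ Tr k p q := by
    rintro k ⟨a, b⟩ ⟨ha, hb, reg, hspan, hpa, hpb, hdomk, hle⟩
    haveI : IsRegularLocalRing (quadraticSeq O R k) := reg
    have hne : maximalIdeal (quadraticSeq O R k) ≠ ⊥ := by
      intro h
      have hmem : (⟨a, ha⟩ : quadraticSeq O R k) ∈ maximalIdeal (quadraticSeq O R k) := by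
        rw [hspan]; exact Ideal.subset_span (by simp)
      rw [h, Ideal.mem_bot] at hmem
      exact hpa.ne_zero hmem
    have hq : IsQuadraticTransformAlong O (quadraticSeq O R k) (quadraticSeq O R (k + 1)) :=
      quadraticSeq_succ_of_exists (exists_isQuadraticTransformAlong hdomk.1 hne)
    have hofk : IsLocalRingOf (quadraticSeq O R k) := isLocalRingOf_of_le hof hle
    obtain ⟨h₁, x₁, y₁, hspan₁, hp₁, hp₁', ⟨a₁, b₁, u₁, hu₁, hxeq⟩, ⟨a₂, b₂, u₂, hu₂, hyeq⟩⟩ :=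
      stub_zariskiFrameStep O (quadraticSeq O R k) (quadraticSeq O R (k + 1)) hofk hdomk hq
        ⟨a, ha⟩ ⟨b, hb⟩ hspan hpa hpb
    refine ⟨hq, ((x₁ : K), (y₁ : K)), ⟨x₁.2, y₁.2, h₁, ?_, ?_, ?_, hq.dominated, hle.trans hq.le⟩,
      ⟨a₁, b₁, (u₁ : K), u₁.2, ?_, hxeq⟩, ⟨a₂, b₂, (u₂ : K), u₂.2, ?_, hyeq⟩⟩
    · simpa using hspan₁
    · simpa using hp₁
    · simpa using hp₁'
    · simpa using hu₁
    · simpa using hu₂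
  -- the initial frame: a regular system of parameters of `R`
  obtain ⟨x₀, y₀, hspan₀, hpx₀, hpy₀, -, -⟩ := exists_maximalIdeal_eq_span_pair (R := R) hdim
  have good₀ : Good 0 ((x₀ : K), (y₀ : K)) := by
    show ∃ (ha : (x₀ : K) ∈ R) (hb : (y₀ : K) ∈ R) (reg : IsRegularLocalRing R),
      @maximalIdeal R _ reg.toIsLocalRing = Ideal.span {(⟨(x₀ : K), ha⟩ : R), ⟨(y₀ : K), hb⟩} ∧
        Prime (⟨(x₀ : K), ha⟩ : R) ∧ Prime (⟨(y₀ : K), hb⟩ : R) ∧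
        SubringDominates R O.toSubring ∧ R ≤ R
    exact ⟨x₀.2, y₀.2, ‹IsRegularLocalRing R›, hspan₀, hpx₀, hpy₀, hdom, le_rfl⟩
  -- the recursively chosen sequence of frames
  let seq : ℕ → K × K := fun k =>
    Nat.rec ((x₀ : K), (y₀ : K)) (fun k p => Classical.epsilon fun q => Good (k + 1) q ∧ Tr k p q) k
  have seq_succ : ∀ k, seq (k + 1) =
      Classical.epsilon (fun q => Good (k + 1) q ∧ Tr k (seq k) q) := fun k => rfl
  have good : ∀ k, Good k (seq k) ∧ Tr k (seq k) (seq (k + 1)) := by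
    have hG : ∀ k, Good k (seq k) := by
      intro k
      induction k with
      | zero => exact good₀
      | succ k ih =>
        rw [seq_succ]
        exact (Classical.epsilon_spec (p := fun q => Good (k + 1) q ∧ Tr k (seq k) q)
          (step k _ ih).2).1
    intro k
    refine ⟨hG k, ?_⟩
    rw [seq_succ]
    exact (Classical.epsilon_spec (p := fun q => Good (k + 1) q ∧ Tr k (seq k) q)
      (step k _ (hG k)).2).2
  -- unpack
  have hmem₁ : ∀ n, (seq n).1 ∈ quadraticSeq O R n := fun n => (good n).1.1
  have hmem₂ : ∀ n, (seq n).2 ∈ quadraticSeq O R n := fun n => (good n).1.2.1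
  have hreg : ∀ n, IsRegularLocalRing (quadraticSeq O R n) := fun n => (good n).1.2.2.1
  refine ⟨hreg, fun n => ⟨(seq n).1, hmem₁ n⟩, fun n => ⟨(seq n).2, hmem₂ n⟩,
    fun i => (step i _ (good i).1).1, fun n => (good n).1.2.2.2.1,
    fun n => ⟨(good n).1.2.2.2.2.1, (good n).1.2.2.2.2.2.1⟩, fun n => ?_⟩
  obtain ⟨⟨a₁, b₁, u₁, hu₁, hU₁, h₁⟩, ⟨a₂, b₂, u₂, hu₂, hU₂, h₂⟩⟩ := (good n).2
  exact ⟨⟨a₁, b₁, ⟨u₁, hu₁⟩, hU₁, h₁⟩, ⟨a₂, b₂, ⟨u₂, hu₂⟩, hU₂, h₂⟩⟩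

/-! ## Zariski's lemma, Archimedean case -/

/-- **Zariski's monomialisation along a valuation (Archimedean case).** Let `R` be a
two-dimensional regular local ring of `K` (with fraction field `K`) dominated by the valuation ring
`O`, such that every nonzero element of `R` has finite value (`ν(w) > ν(f)` for all `w ∈ 𝔪^N`, some
`N`). Then finitely many nonzero elements `f₁, …, f_m` of `R` are units times monomials `xᵃ yᵇ` in a
generating pair `𝔪 = (x, y)` of the maximal ideal of some iterated quadratic transform of `R` along
`O`. Proof: choose prime frames along the sequence of transforms (`exists_frames_quadraticSeq`),
monomialise the product `∏ f_j` (finite value) by `stub_zariskiFiniteValue`, and peel the prime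
generators off each factor. [cite: ZariskiSamuel1960, Vol. II, Appendix 5] -/
theorem stub_zariskiMonomialArchimedean {K : Type} [Field K]
    (O : ValuationSubring K) (R : Subring K) [IsRegularLocalRing R]
    (hdim : ringKrullDim R = 2) (hof : IsLocalRingOf R) (hdom : SubringDominates R O.toSubring)
    (harch : ∀ f : R, f ≠ 0 → ∃ N : ℕ, ∀ w ∈ (IsLocalRing.maximalIdeal R) ^ N,
      O.valuation ((w : R) : K) < O.valuation ((f : R) : K))
    {m : ℕ} (f : Fin m → R) (hf : ∀ j, f j ≠ 0) :
    ∃ (R₁ : Subring K) (h₁ : IsLocalRing R₁),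
      Relation.ReflTransGen (IsQuadraticTransformAlong O) R R₁ ∧
      ∃ x y : R₁, @IsLocalRing.maximalIdeal R₁ _ h₁ = Ideal.span {x, y} ∧
        ∀ j, ∃ (a b : ℕ) (u : R₁), IsUnit u ∧ ((f j : K)) = (u : K) * (x : K) ^ a * (y : K) ^ b := by
  classical
  obtain ⟨reg, x, y, hstep, hframe, hprime, htrans⟩ := exists_frames_quadraticSeq O R hdim hof hdom
  -- the product has finite value
  set F : R := ∏ j, f j with hFdef
  have hF : F ≠ 0 := Finset.prod_ne_zero_iff.2 fun j _ => hf j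
  obtain ⟨N, hN⟩ := harch F hF
  -- monomialise the product along the sequence
  obtain ⟨n, A, B, U, hU, hFeq⟩ :=
    stub_zariskiFiniteValue O (quadraticSeq O R) hdim hof hdom hstep (fun n => (reg n).toIsLocalRing)
      x y hframe hprime htrans F hF ⟨N, hN⟩
  haveI : IsRegularLocalRing (quadraticSeq O R n) := reg n
  have hle : R ≤ quadraticSeq O R n := by
    have key : ∀ k, R ≤ quadraticSeq O R k := fun k => by
      induction k with
      | zero => exact le_rfl
      | succ k ih => exact ih.trans (hstep k).le
    exact key n
  refine ⟨quadraticSeq O R n, (reg n).toIsLocalRing, reflTransGen_quadraticSeq O R hstep n,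
    x n, y n, hframe n, fun j => ?_⟩
  -- `f j` divides the product, inside the domain `quadraticSeq O R n`
  have hFG : F = f j * ∏ i ∈ Finset.univ.erase j, f i := by
    rw [hFdef, Finset.mul_prod_erase _ _ (Finset.mem_univ j)]
  have heq : Subring.inclusion hle (f j) * Subring.inclusion hle (∏ i ∈ Finset.univ.erase j, f i) =
      U * x n ^ A * y n ^ B := by
    apply Subtype.ext
    have h1 : ((F : R) : K) = ((f j : R) : K) * ((∏ i ∈ Finset.univ.erase j, f i : R) : K) := by
      rw [hFG]; rfl
    simp only [Subring.coe_mul, Subring.coe_pow, Subring.coe_inclusion]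
    rw [← h1, hFeq]
  obtain ⟨a, b, U', hU', hfS⟩ :=
    exists_eq_unit_mul_pow_mul_pow_of_mul_eq (hprime n).1 (hprime n).2 A B _ _ U hU heq
  refine ⟨a, b, U', hU', ?_⟩
  have := congrArg (fun s : quadraticSeq O R n => (s : K)) hfS
  simpa using this

end Summit.ResolutionOfSingularities.ResolutionOfSingularities.Theorems.TeissierReduction

end
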